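import Summits.QuantumAdvantage.QuantumAdvantage.Theorems.RingFrameRingHardLogDegOfRingHard
import Summits.QuantumAdvantage.QuantumAdvantage.Theorems.RingFrameRingToElimTube
import HarnessLib

/-!
# Route RingFrame, aside `RingHardLogDeg` (stmt-QuantumAdvantage-19453) — PROVED

The aside `RingHardLogDeg` (an absolute `θ < 1` bounding the success of every tuple of
`𝔽₂`-polynomials of degree `≤ log₄ n − log₄(log₂ n + 1) − 3` on the `n`-cycle relation `RingHLF.Rel`)
is the `c = 1` instance of the rung leaf `RingHard 2` up to `lowDeg_mono`
(`ringHardLogDeg_of_ringToElim`, `RingFrameRingHardLogDegOfRingHard.lean`, prover qn-prover-3 gen 7),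
and the crux α `RingToElim` is now a theorem of the tree (`ringToElim_tube`,
`RingFrameRingToElimTube.lean`: the cell's tube bound — planner qa-qnc0-p2 ROUND-11, prover qa-qnc0-prover
gen 9, with qn-lit gen 13's binomial tail).  Hence:

* `ringHardLogDeg_proof : RingHardLogDeg`.

WHAT THIS IS NOT: nothing beyond the composition; the mathematics is the tube bound's.
-/

-- the sub-problem namespace `Summit.QuantumAdvantage.QuantumAdvantage` repeats the summit name by design (D-0017)
set_option linter.dupNamespace false

namespace Summit.QuantumAdvantage.QuantumAdvantage.Theorems

/-- **The aside `RingHardLogDeg` of route RingFrame holds** (from the crux `RingToElim` by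
monotonicity of `lowDeg` in the degree). -/
theorem ringHardLogDeg_proof : Summit.QuantumAdvantage.QuantumAdvantage.Theses.RingFrame.RingHardLogDeg :=
  ringHardLogDeg_of_ringToElim ringToElim_tube

end Summit.QuantumAdvantage.QuantumAdvantage.Theorems
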